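import Literature.AlgebraicGeometry.HodgeTheory.SemiregularReducedObstructions
import Literature.AlgebraicGeometry.Modules.VectorBundleFiniteLocallyFree
import HarnessLib

/-!
# Venture HSemireg — the FORMAL step of the amplification chain, in the kernel (sheaf level): the small-extension
# lifting property (Pridham's conclusion) ITERATED along the `𝔪`-adic filtration ⟹ the vector bundle lifts over
# EVERY Artinian point of the base centred at `s₀`

HONEST FRAMING. Lean index of the computation cell `pub-hsemireg` (seat p7, «assembly»). Nothing about any explicit
variety is asserted; nothing here says HC, HC_CM or HC_AV is proved. Theorems only (0 `def`, 0 `sorry`, no new axiom, no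
named fact declared); pure deformation-theoretic bookkeeping on the tree's REAL carriers (`Deformation.LiftsAlong`,
`Motives.IsVectorBundle`, Mathlib's `IsPullback` / `Scheme.Modules.pullback` / `IsArtinianRing`).

## What is proved

Theory seat 3's split of «formal ⟹ algebraic along the component» (`theory/TH3-ALGEBRAISATION.md` §0) is (F) FORMAL ·
(E) effectivity · (C) convergence · (G) globalisation. Bloch's (7.1) does (F) for lci subschemes by «applying (6.10), we may
lift step by step to find `Z_N ⊂ X_N = X ×_S S_N` flat over `S_N`» (p. 64). The tree's refereed rendering of Pridham's
Cor. 2.25 + Rem. 2.27 (`Pridham2024_ISemiregular_liftsOverHodgeLocus_model`, seat lit-3) delivers the ONE-STEP statement for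
vector bundles: lifting across every SMALL extension `A ↠ B` (`𝔪_A · ker = 0`) at every Artinian point of `S` centred at
`s₀`; its module docstring leaves the row «the assembly seat (p7): iterate this fact along small extensions» open. THIS
FILE does the iteration, with no input other than the lifting property itself:

* §1 `exists_vectorBundle_pullback_iso_of_maximalIdeal_eq_bot` — base: if `𝔪_A = 0` the `ℂ`-point `ρ_A` is an
  isomorphism `A ≅ ℂ`, so the closed-fibre embedding `j_A : X₀ ⟶ X_A` (a base change of `Spec ρ_A`) is an isomorphism
  and `E₀` carried along it is the lift.
* §1 `exists_vectorBundle_pullback_iso_of_liftsOverArtinianPointsAt` — THE ITERATION: for a vector bundle `E₀` on a model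
  `e : X₀ ≅ 𝒳_{s₀}` with the small-extension lifting property at `s₀` (BY NAME: seat lit-3's `LiftsOverArtinianPointsAt π s₀ X₀ e E₀`,
  `SemiregularReducedObstructions.lean`, = the fact's conclusion λ-abstracted), for EVERY
  local Artinian `ℂ`-algebra `A` with a `ℂ`-point `ρ_A`, every `A`-point `a` of `S` centred at `s₀`, every base change
  `X_A = 𝒳 ×_S Spec A` and closed-fibre embedding `j_A : X₀ ⟶ X_A` compatible with `e`, there is a VECTOR BUNDLE `G` on
  `X_A` with `j_A^* G ≅ E₀`. Proof: induction on `N` with `𝔪_A^N = 0` (`𝔪_A` is nilpotent: Artinian local), the step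
  being the small extension `A ↠ A ⧸ 𝔪_A^N` (kernel `𝔪_A^N`, killed by `𝔪_A`), the base change
  `X_{A/𝔪^N} = X_A ×_{Spec A} Spec (A ⧸ 𝔪^N)` (Mathlib `pullback`), the induced closed-fibre embedding (pasting of pullback
  squares), the induction hypothesis on `A ⧸ 𝔪_A^N` (still local Artinian, `𝔪^N = 0` there, `ℂ`-point induced), then
  ONE application of the lifting property, and `j_A^* G ≅ j_B^* i^* G ≅ j_B^* F ≅ E₀` (`Scheme.Modules.pullbackComp`).
* §2 `Pridham2024.exists_vectorBundle_over_artinianPoint` — COMPOSITION with the refereed fact BY NAME: an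
  `I`-semiregular finite locally free `E₀` on a model of the fibre at `s₀` of a smooth projective family over a smooth
  base, whose classes `ch_p(E₀)` (`p ∈ I`) stay of type `(p, p)` on `U`, lifts to a vector bundle over EVERY Artinian
  point of `S` centred at `s₀` — a FORMAL DEFORMATION of `E₀` along (the formal germ of) the base, the sheaf analogue of
  Bloch's `(Z_N)_N`. Trust base: the fact `Pridham2024_ISemiregular_liftsOverHodgeLocus_model` (hypothesis BY NAME).

What is NOT here: compatibility of the lifts for varying `A` (a formal SYSTEM `(G_N)_N` with `G_{N+1}|_{X_N} ≅ G_N` —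
the induction produces it but the statement records existence at each `A` only), effectivity / algebraisation
((E)+(C): `AmplificationChainPridham.lean` §1's assumption BY NAME), anything Hodge-theoretic beyond the fact's hypotheses.

References: [Pridham2024Semiregularity] J. P. Pridham, Forum Math. Sigma 12 (2024) e126, Cor. 2.25, Rem. 2.27, Rem. 2.21,
Lemma 1.8–1.9 · [Bloch1972Semiregularity] S. Bloch, Invent. Math. 17 (1972), proof of Thm. (7.1), p. 64 («lift step by
step») · [StacksProject] Tag 08VR (the carrier `LiftsAlong`), Tag 00J8 (nilpotency of the maximal ideal of an Artinian
local ring) · [Schlessinger1968] M. Schlessinger, Trans. AMS 130 (1968), §1 (small extensions generate).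
-/

noncomputable section

open CategoryTheory CategoryTheory.Limits AlgebraicGeometry
open Literature.AlgebraicGeometry.Motives Literature.AlgebraicGeometry.HodgeTheory
open Literature.AlgebraicTopology.SingularHomology
open Literature.AlgebraicGeometry.Deformation (LiftsAlong)

namespace Summit.Ventures.HSemireg

/-! ## §1 The iteration (pure deformation theory: no Hodge theory, no semiregularity) -/

section Iteration

variable {𝒳 S : SchemeOver ℂ} {π : 𝒳 ⟶ S} {s₀ : ComplexPoints S} {X₀ : SchemeOver ℂ}
  {e : X₀ ≅ fiberOver π s₀} {E₀ : X₀.left.Modules}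

/-- **Base of the iteration: `𝔪_A = 0`.** Then the `ℂ`-point `ρ_A : A → ℂ` is bijective (its kernel is the maximal
ideal), `Spec ρ_A` is an isomorphism, hence so is its base change, the closed-fibre embedding `j_A : X₀ ⟶ X_A`
(`IsPullback.isIso_fst_of_isIso`); the vector bundle `(j_A⁻¹)^* E₀` on `X_A` restricts to `E₀`
(`Scheme.Modules.pullbackComp`, `pullbackId`). [folklore] -/
theorem exists_vectorBundle_pullback_iso_of_maximalIdeal_eq_bot (hE₀ : IsVectorBundle E₀)
    (A : Type) [CommRing A] [Algebra ℂ A] [IsLocalRing A] (ρA : A →ₐ[ℂ] ℂ)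
    (hm : IsLocalRing.maximalIdeal A = ⊥) {XA : Scheme} (qA : XA ⟶ Spec (.of A)) (jA : X₀.left ⟶ XA)
    (hjA : IsPullback jA X₀.hom qA (Spec.map (CommRingCat.ofHom ρA.toRingHom))) :
    ∃ G : XA.Modules, IsVectorBundle G ∧ Nonempty ((Scheme.Modules.pullback jA).obj G ≅ E₀) := by
  -- `ρA` is bijective, so `Spec.map ρA` is an isomorphism, hence so is its base change `jA`
  have hbij : Function.Bijective ρA := by
    constructor
    · have : RingHom.ker ρA.toRingHom = ⊥ := by
        have hmax : (RingHom.ker ρA.toRingHom).IsMaximal :=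
          RingHom.ker_isMaximal_of_surjective ρA.toRingHom (fun z => ⟨algebraMap ℂ A z, by simp⟩)
        rw [IsLocalRing.eq_maximalIdeal hmax, hm]
      exact (RingHom.injective_iff_ker_eq_bot ρA.toRingHom).2 this
    · exact fun z => ⟨algebraMap ℂ A z, by simp⟩
  have hiso : IsIso (Spec.map (CommRingCat.ofHom ρA.toRingHom)) := by
    have : IsIso (CommRingCat.ofHom ρA.toRingHom) := by
      have : IsIso ((forget CommRingCat).map (CommRingCat.ofHom ρA.toRingHom)) :=
        (isIso_iff_bijective _).2 hbij
      exact isIso_of_reflects_iso _ (forget CommRingCat)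
    infer_instance
  haveI : IsIso jA := hjA.isIso_fst_of_isIso
  refine ⟨(Scheme.Modules.pullback (inv jA)).obj E₀, hE₀.pullback (inv jA), ⟨?_⟩⟩
  exact (Scheme.Modules.pullbackComp jA (inv jA)).app E₀ ≪≫
    eqToIso (by rw [IsIso.hom_inv_id]) ≪≫ (Scheme.Modules.pullbackId _).app E₀

/-- **THE ITERATION — «lift step by step»: the small-extension lifting property of `E₀` at `s₀` ⟹ `E₀` lifts to a
vector bundle over EVERY Artinian point of `S` centred at `s₀`.** Hypotheses: a vector bundle `E₀` on a model
`e : X₀ ≅ 𝒳_{s₀}` of the fibre of `π : 𝒳 ⟶ S` at the `ℂ`-point `s₀`; `hlift : LiftsOverArtinianPointsAt π s₀ X₀ e E₀` = the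
small-extension lifting property BY NAME (seat lit-3's predicate = the conclusion of the tree's
`Pridham2024_ISemiregular_liftsOverHodgeLocus_model`, λ-abstracted: for every small
`f : A ↠ B`, `ℂ`-point `ρ` of `B`, `A`-point `a` of `S` centred at `s₀`, base changes `X_A`, `X_B` and closed fibre
`j : X₀ ⟶ X_B` compatible with `e`, every vector bundle on `X_B` restricting to `E₀` lifts along `X_B ⟶ X_A`).
Conclusion: for every local Artinian `ℂ`-algebra `A` with `ℂ`-point `ρ_A`, every `A`-point `a` of `S` centred at `s₀`,
every base change `(X_A, g_A, q_A)` of `π` along `a` and closed-fibre embedding `j_A : X₀ ⟶ X_A` over `Spec ρ_A` with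
`j_A ≫ g_A = e ≫ (𝒳_{s₀} ⟶ 𝒳)`, some vector bundle `G` on `X_A` has `j_A^* G ≅ E₀`. Proof: `𝔪_A` is nilpotent
([StacksProject, Tag 00J8]; Mathlib `IsArtinianRing.isNilpotent_jacobson_bot`); induction on `N` with `𝔪_A^N = 0`: the
base `𝔪_A = 0` is the previous theorem; for the step, `A ↠ B := A ⧸ 𝔪_A^N` is SMALL (`𝔪_A · 𝔪_A^N = 𝔪_A^{N+1} = 0`), `B`
is local Artinian with `𝔪_B^N = 0` and `ℂ`-point `ρ_B` induced by `ρ_A` (`𝔪_A^N ≤ 𝔪_A = ker ρ_A`); `X_B := X_A ×_A B`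
(Mathlib `pullback`), `j_B : X₀ ⟶ X_B` the induced map (a pullback square by pasting, `IsPullback.of_right`), the `B`-point
`Spec B → Spec A → S` is centred at `s₀`; the induction hypothesis gives `F` on `X_B` with `j_B^* F ≅ E₀`, ONE
application of `hlift` gives `G` on `X_A` with `i^* G ≅ F`, and `j_A^* G ≅ j_B^* i^* G ≅ j_B^* F ≅ E₀`. This is the
sheaf analogue of Bloch's «applying (6.10), we may lift step by step to find `Z_N ⊂ X_N`».
[cite: Bloch1972Semiregularity, proof of Thm. (7.1), p. 64] [cite: StacksProject, Tag 00J8 and Tag 08VR] -/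
theorem exists_vectorBundle_pullback_iso_of_liftsOverArtinianPointsAt (hE₀ : IsVectorBundle E₀)
    (hlift : LiftsOverArtinianPointsAt π s₀ X₀ e E₀)
    (A : Type) [CommRing A] [Algebra ℂ A] [IsArtinianRing A] [IsLocalRing A] (ρA : A →ₐ[ℂ] ℂ)
    (a : specOver ℂ A ⟶ S) (ha : Spec.map (CommRingCat.ofHom ρA.toRingHom) ≫ a.left = s₀.left)
    {XA : Scheme} (gA : XA ⟶ 𝒳.left) (qA : XA ⟶ Spec (.of A)) (hA : IsPullback gA qA π.left a.left)
    (jA : X₀.left ⟶ XA) (hjA : IsPullback jA X₀.hom qA (Spec.map (CommRingCat.ofHom ρA.toRingHom)))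
    (hje : jA ≫ gA = e.hom.left ≫ (fiberι π s₀).left) :
    ∃ G : XA.Modules, IsVectorBundle G ∧ Nonempty ((Scheme.Modules.pullback jA).obj G ≅ E₀) := by
  -- `𝔪_A` is nilpotent: induct on the exponent, for all `A` at once
  obtain ⟨N, hN⟩ := IsArtinianRing.isNilpotent_jacobson_bot (R := A)
  rw [IsLocalRing.jacobson_eq_maximalIdeal ⊥ bot_ne_top] at hN
  suffices key : ∀ (N : ℕ) (A : Type) [CommRing A] [Algebra ℂ A] [IsArtinianRing A] [IsLocalRing A]
      (ρA : A →ₐ[ℂ] ℂ), IsLocalRing.maximalIdeal A ^ N = ⊥ → ∀ (a : specOver ℂ A ⟶ S),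
      Spec.map (CommRingCat.ofHom ρA.toRingHom) ≫ a.left = s₀.left →
      ∀ ⦃XA : Scheme⦄ (gA : XA ⟶ 𝒳.left) (qA : XA ⟶ Spec (.of A)), IsPullback gA qA π.left a.left →
        ∀ (jA : X₀.left ⟶ XA), IsPullback jA X₀.hom qA (Spec.map (CommRingCat.ofHom ρA.toRingHom)) →
          jA ≫ gA = e.hom.left ≫ (fiberι π s₀).left →
          ∃ G : XA.Modules, IsVectorBundle G ∧ Nonempty ((Scheme.Modules.pullback jA).obj G ≅ E₀) from
    key N A ρA hN a ha gA qA hA jA hjA hje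
  intro N
  induction N with
  | zero =>
    intro A _ _ _ _ ρA hN a ha
    rw [pow_zero, Ideal.one_eq_top] at hN
    exact absurd hN top_ne_bot
  | succ N ih =>
    intro A _ _ _ _ ρA hN a ha XA gA qA hA jA hjA hje
    by_cases hm : IsLocalRing.maximalIdeal A = ⊥
    · exact exists_vectorBundle_pullback_iso_of_maximalIdeal_eq_bot hE₀ A ρA hm qA jA hjA
    -- `N ≥ 1`, and the small extension `f : A ↠ B := A ⧸ 𝔪^N`
    have hN0 : N ≠ 0 := by
      rintro rfl
      exact hm (by simpa using hN)
    set I : Ideal A := IsLocalRing.maximalIdeal A ^ N with hIdef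
    have hI : I ≠ ⊤ := fun h =>
      IsLocalRing.maximalIdeal.isMaximal A |>.ne_top (top_le_iff.mp (h ▸ Ideal.pow_le_self hN0))
    haveI : Nontrivial (A ⧸ I) := Ideal.Quotient.nontrivial_iff.mpr hI
    haveI : IsLocalRing (A ⧸ I) := IsLocalRing.of_surjective' (Ideal.Quotient.mk I) Ideal.Quotient.mk_surjective
    let f : A →ₐ[ℂ] A ⧸ I := Ideal.Quotient.mkₐ ℂ I
    have hf : Function.Surjective f := Ideal.Quotient.mkₐ_surjective ℂ I
    have hker : RingHom.ker f = I := Ideal.Quotient.mkₐ_ker ℂ I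
    have hsmall : IsLocalRing.maximalIdeal A * RingHom.ker f = ⊥ := by
      rw [hker, hIdef, ← pow_succ', hN]
    -- the `ℂ`-point of `B`
    have hkerρ : RingHom.ker ρA.toRingHom = IsLocalRing.maximalIdeal A :=
      IsLocalRing.eq_maximalIdeal
        (RingHom.ker_isMaximal_of_surjective ρA.toRingHom (fun z => ⟨algebraMap ℂ A z, by simp⟩))
    have hIρ : ∀ x : A, x ∈ I → ρA x = 0 := fun x hx => by
      have : x ∈ RingHom.ker ρA.toRingHom := hkerρ ▸ Ideal.pow_le_self hN0 hx
      simpa using this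
    let ρB : A ⧸ I →ₐ[ℂ] ℂ := Ideal.Quotient.liftₐ I ρA hIρ
    have hρ : ρB.comp f = ρA := Ideal.Quotient.liftₐ_comp I ρA hIρ
    -- `𝔪_B ^ N = 0`
    have hBN : IsLocalRing.maximalIdeal (A ⧸ I) ^ N = ⊥ := by
      have hmap : (IsLocalRing.maximalIdeal A).map (Ideal.Quotient.mk I) = IsLocalRing.maximalIdeal (A ⧸ I) := by
        have := IsLocalHom.of_surjective (Ideal.Quotient.mk I) Ideal.Quotient.mk_surjective
        ext x
        obtain ⟨x, rfl⟩ := Ideal.Quotient.mk_surjective x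
        simp [sup_eq_left.mpr (IsLocalRing.le_maximalIdeal hI)]
      rw [← hmap, ← Ideal.map_pow, ← hIdef, Ideal.map_quotient_self]
    -- scheme side: `X_B := X_A ×_{Spec A} Spec B`, the induced closed fibre `j_B`, the `B`-point `a_B`
    let f' : CommRingCat.of A ⟶ CommRingCat.of (A ⧸ I) := CommRingCat.ofHom f.toRingHom
    let ρB' : CommRingCat.of (A ⧸ I) ⟶ CommRingCat.of ℂ := CommRingCat.ofHom ρB.toRingHom
    have hρ' : CommRingCat.ofHom ρA.toRingHom = f' ≫ ρB' := by
      rw [← hρ]; rfl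
    have hB : IsPullback (pullback.fst qA (Spec.map f')) (pullback.snd qA (Spec.map f')) qA (Spec.map f') :=
      IsPullback.of_hasPullback qA (Spec.map f')
    set i := pullback.fst qA (Spec.map f') with hidef
    set qB := pullback.snd qA (Spec.map f') with hqBdef
    have hw : jA ≫ qA = (X₀.hom ≫ Spec.map ρB') ≫ Spec.map f' := by
      rw [hjA.w, hρ', Spec.map_comp, Category.assoc]
    let jB := hB.lift jA (X₀.hom ≫ Spec.map ρB') hw
    have hjBi : jB ≫ i = jA := hB.lift_fst _ _ _
    have hjBq : jB ≫ qB = X₀.hom ≫ Spec.map ρB' := hB.lift_snd _ _ _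
    have hjB : IsPullback jB X₀.hom qB (Spec.map ρB') := by
      refine IsPullback.of_right ?_ hjBq hB
      rw [hjBi, ← Spec.map_comp, ← hρ']
      exact hjA
    have hwa : a.left ≫ S.hom = Spec.map (CommRingCat.ofHom (algebraMap ℂ A)) := Over.w a
    have hwB : (Spec.map f' ≫ a.left) ≫ S.hom = Spec.map (CommRingCat.ofHom (algebraMap ℂ (A ⧸ I))) := by
      erw [Category.assoc, hwa, ← Spec.map_comp, ← CommRingCat.ofHom_comp, f.comp_algebraMap]
    let aB : specOver ℂ (A ⧸ I) ⟶ S := Over.homMk (Spec.map f' ≫ a.left) hwB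
    have haB : Spec.map ρB' ≫ aB.left = s₀.left := by
      change Spec.map ρB' ≫ Spec.map f' ≫ a.left = s₀.left
      rw [← Category.assoc, ← Spec.map_comp, ← hρ', ha]
    have hAB : IsPullback (i ≫ gA) qB π.left aB.left := hB.paste_horiz hA
    have hjeB : jB ≫ (i ≫ gA) = e.hom.left ≫ (fiberι π s₀).left := by
      rw [← Category.assoc, hjBi, hje]
    -- induction hypothesis on `B`, then ONE lifting step along `i : X_B ⟶ X_A`
    obtain ⟨F, hF, ⟨eF⟩⟩ := ih (A ⧸ I) ρB hBN aB haB (i ≫ gA) qB hAB jB hjB hjeB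
    have ha' : Spec.map (CommRingCat.ofHom (ρB.comp f).toRingHom) ≫ a.left = s₀.left := by rw [hρ]; exact ha
    obtain ⟨G, hG, ⟨eG⟩⟩ := hlift A (A ⧸ I) f hf hsmall ρB a ha' gA qA hA i qB hB jB hjB hjeB F hF ⟨eF⟩
    refine ⟨G, hG, ⟨?_⟩⟩
    exact eqToIso (by rw [← hjBi]) ≪≫ ((Scheme.Modules.pullbackComp jB i).app G).symm ≪≫
      (Scheme.Modules.pullback jB).mapIso eG ≪≫ eF

end Iteration

/-! ## §2 Composition with Pridham's refereed fact BY NAME: a semiregular vector bundle on the Hodge locus deforms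
over EVERY Artinian point of the base centred at `s₀` -/

section Pridham

/-- **The FORMAL step (F) for sheaves, kernel-composed: Pridham's Cor. 2.25 + Rem. 2.27 (tree fact, BY NAME) ⟹ `E₀` lifts
to a vector bundle over EVERY Artinian point of `S` centred at `s₀`.** Binders: those of the fact's `Finset` form
(`C`; `π : 𝒳 ⟶ S` smooth projective of relative dimension `n` over a smooth `S`; `U ∋ s₀` cohomologically locally trivial;
a model `e : X₀ ≅ 𝒳_{s₀}`; `E₀` finite locally free with `(σ_{p-1})_{p ∈ I}` jointly injective; the transports of
`(e⁻¹)^* ch_p(E₀)` of type `(p, p)` on `U` for `p ∈ I`), then a local Artinian `ℂ`-algebra `A` with `ℂ`-point `ρ_A`, an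
`A`-point `a` of `S` centred at `s₀`, a base change `(X_A, g_A, q_A)` and a closed-fibre embedding `j_A` compatible with
`e`. Conclusion: a vector bundle `G` on `X_A` with `j_A^* G ≅ E₀`. The fact gives the small-extension lifting property
(seat lit-3's `Pridham2024_ISemiregular_liftsOverArtinianPointsAt_finset` : `LiftsOverArtinianPointsAt π s₀ X₀ e E₀`); §1 iterates it. CONDITIONAL on the fact (an
unproved Literature `Prop`, hypothesis `hP`). [cite: Pridham2024Semiregularity, Cor. 2.25; Rem. 2.27; Rem. 2.21; Lemma 1.8–1.9]
[cite: Bloch1972Semiregularity, proof of Thm. (7.1), p. 64 (the «step by step» iteration, for subschemes)] -/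
theorem Pridham2024.exists_vectorBundle_over_artinianPoint
    (hP : Pridham2024_ISemiregular_liftsOverHodgeLocus_model) (C : ChernCharacterBetti)
    {𝒳 S : SchemeOver ℂ} (π : 𝒳 ⟶ S) (n : ℕ) (hπ : IsSmoothProjectiveFamily π n)
    (hS : _root_.AlgebraicGeometry.Smooth S.hom) {U : Set (ComplexPoints S)}
    (hU : IsCohomologicallyLocallyTrivialOn π U) (s₀ : U) (X₀ : SchemeOver ℂ)
    (e : X₀ ≅ fiberOver π s₀.1) (E₀ : X₀.left.Modules) (hE₀ : IsFiniteLocallyFree E₀)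
    (I : Finset ℕ) (hsr : IsISemiregular hE₀ {q | q + 1 ∈ I})
    (hHodge : ∀ p ∈ I, ∀ (t : U) (γ : Path.Homotopic.Quotient s₀ t),
      IsOfHodgeType n (fiberOver π t.1) (2 * p) p p
        (transportFun π (2 * p) hU γ (complexBetti.map e.inv (2 * p) (C.ch X₀ E₀ p))))
    (A : Type) [CommRing A] [Algebra ℂ A] [IsArtinianRing A] [IsLocalRing A] (ρA : A →ₐ[ℂ] ℂ)
    (a : specOver ℂ A ⟶ S) (ha : Spec.map (CommRingCat.ofHom ρA.toRingHom) ≫ a.left = s₀.1.left)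
    {XA : Scheme} (gA : XA ⟶ 𝒳.left) (qA : XA ⟶ Spec (.of A)) (hA : IsPullback gA qA π.left a.left)
    (jA : X₀.left ⟶ XA) (hjA : IsPullback jA X₀.hom qA (Spec.map (CommRingCat.ofHom ρA.toRingHom)))
    (hje : jA ≫ gA = e.hom.left ≫ (fiberι π s₀.1).left) :
    ∃ G : XA.Modules, IsVectorBundle G ∧ Nonempty ((Scheme.Modules.pullback jA).obj G ≅ E₀) :=
  exists_vectorBundle_pullback_iso_of_liftsOverArtinianPointsAt hE₀.isVectorBundle
    (Pridham2024_ISemiregular_liftsOverArtinianPointsAt_finset hP C π n hπ hS hU s₀ X₀ e E₀ hE₀ I hsr hHodge)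
    A ρA a ha gA qA hA jA hjA hje

end Pridham

end Summit.Ventures.HSemireg

end
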